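import Mathlib
import HarnessLib
import Summits.ResolutionOfSingularities.ResolutionOfSingularities.Theorems.HomologicalConductorNoZenoSkyPointLifts
import Summits.ResolutionOfSingularities.ResolutionOfSingularities.Theorems.HomologicalConductorNoZenoSkyBridge
import Summits.ResolutionOfSingularities.ResolutionOfSingularities.Theorems.HomologicalConductorNoZenoCarriedPrincipalClosed
import Summits.ResolutionOfSingularities.ResolutionOfSingularities.Theorems.HomologicalConductorNoZenoCaPrimaryTower
import Summits.ResolutionOfSingularities.ResolutionOfSingularities.Theorems.HomologicalConductorNoZenoSurfaceCore
import Summits.ResolutionOfSingularities.ResolutionOfSingularities.Theorems.HomologicalConductorNoZenoCaInvertibleRational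
import Summits.ResolutionOfSingularities.ResolutionOfSingularities.Theorems.HomologicalConductorSurfaceTerminationRationalPropagation

/-!
# Kill test `SurfaceTermination` (stmt-ResolutionOfSingularities-16488): CAPTURE-PRINCIPAL — above a
# RATIONAL singular stage of the `ca`-tower, `ca(T)·S` is principal at every regular local ring `S ⊇ T`
# dominating `T` and essentially of finite type (no sandwich, no sky-point hypotheses)

Route `ResolutionOfSingularities/HomologicalConductor`.  OURS (cell res-hironaka, crux chain W4.4, seat
res-L0-w44-stub-1, object (h3) of res-L0-w44-plan-1 g12 08:51:10Z); nothing here is a statement of the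
manuscript under review (Hironaka 2017); AI-written, weaker than expert review.

For the canonical `ca`-tower of a two-dimensional affine model (`tr.deg_k K = 2`) and a SINGULAR stage
`T = T_(n+1)`:

* `exists_lift_of_isRegularLocalRing_of_essFiniteType` — the LIFTING LEMMA without sky-point hypotheses:
  if `S ⊇ T` is a regular local `k`-subalgebra of `K`, essentially of finite type over `k`, then for every
  minimal resolution `π : X ⟶ Spec T` there is `l : Spec S ⟶ X` with `l ≫ π = Spec (T ↪ S)` — `S` is
  the regular local ring of a point of a birational affine model of finite type over the excellent `T`,
  some resolution passes through it (stub-6's engine `exists_isResolution_through_of_cjsGeneral`,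
  modulo Cossart–Jannsen–Saito 2020 Thm 1.2), and every resolution factors through `π`.  (The registered
  P1.3′ `stub_skyPointLifts` used its sky-point binders only to get «essentially of finite type».)
* **`isPrincipal_map_ca_of_isRegularLocalRing_dominating`** — CAPTURE-PRINCIPAL (the binders of
  res-L0-w44-stub-4's `DescentSketch.stub_capturePrincipal`): for `T` singular with a RATIONAL
  singularity, `S ⊇ T` regular local, dominating `T`, essentially of finite type over `k`: `ca(T)·S`
  (`Ideal.map` along `T ↪ S`) is principal — a minimal resolution exists by Lipman (4.1)
  (`Lipman1969_4_1.exists_isMinimalResolution_Spec`) with `H¹ = 0` by Lipman (1.2)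
  (`Lipman1969_1_2.hasTrivialCechH1_of_isResolution`), THEOREM A for the rational stage holds at every
  point of it (res-D-pv-045's `caInvertible_of_hasTrivialCechH1`, p517833 — this file does not re-derive
  Ga/Gb), the lift exists, and the lead's bridge `caPrincipal_of_invertible_of_lift` transfers
  principality to `S`; `span_ca_isPrincipal_of_isRegularLocalRing_dominating` is the `Ideal.span` form.

Use (DESC-K.md (D1)/(D2), K44S-DESCENT (R2)): the capture step of the exceptional-prime-divisor descent
for rational surface germs along every valuation — `ca(T_j)·S_V` principal at the regular centre `S_V`
of a valuation `V` on a fixed resolution, hence `T_(j+1) ≤ S_V`.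

References: V. Cossart, U. Jannsen, S. Saito, LNM 2270 (2020), Thm 1.2 [`CossartJannsenSaito2020`];
J. Lipman, Publ. IHÉS 36 (1969), Prop. (1.2), Thm. (4.1) [`Lipman1969`].
-/

noncomputable section

-- single-problem summit: the doubled namespace component `ResolutionOfSingularities` is forced
set_option linter.dupNamespace false

namespace Summit.ResolutionOfSingularities.ResolutionOfSingularities.Theorems.SurfaceTermination.RationalDescent

open CategoryTheory AlgebraicGeometry TopologicalSpace IsLocalRing
open Literature.RingTheory.CohomologyAnnihilator (cohomologyAnnihilator)
open Literature.AlgebraicGeometry.Resolution Literature.AlgebraicGeometry.Morphisms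
open Summit.ResolutionOfSingularities.ResolutionOfSingularities.Theorems
open Summit.ResolutionOfSingularities.ResolutionOfSingularities.Theorems.NoZeno.Birth
open Summit.ResolutionOfSingularities.ResolutionOfSingularities.Theorems.NoZeno.SandwichCluster

variable {k K : Type} [Field k] [Field K] [Algebra k K]

/-! ## The lifting lemma without sky-point hypotheses -/

/-- **Lifting a regular essentially-finite-type local ring through a minimal resolution** (modulo
Cossart–Jannsen–Saito 2020, Thm 1.2).  For a singular stage `T = T_(n+1)` of the canonical `ca`-tower
(`tr.deg_k K = 2`), a regular local `k`-subalgebra `S ⊇ T` of `K` essentially of finite type over `k`,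
and a minimal resolution `π : X ⟶ Spec T`: there is `l : Spec S ⟶ X` with `l ≫ π = Spec (T ↪ S)`.
Same construction as the registered P1.3′ (`stub_skyPointLifts`): `S = (B₀)_𝔮` for the finitely
generated model `B₀ ⊆ S` over `T` with a common denominator, a resolution through `S`
(`exists_isResolution_through_of_cjsGeneral`), minimality of `π`.
[cite: CossartJannsenSaito2020, Thm. 1.2] [cite: Lipman1969, Theorem (4.1) (p. 204)] -/
theorem exists_lift_of_isRegularLocalRing_of_essFiniteType
    (hCJS : Literature.AlgebraicGeometry.Resolution.CossartJannsenSaito2020General.{0})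
    (O : ValuationSubring K) (A : Subalgebra k K) (hk : ∀ c : k, algebraMap k K c ∈ O) (hA : A.FG)
    (hfr : IsFractionRing ↥A K) (hAO : A.toSubring ≤ O.toSubring) (htr : Algebra.trdeg k K = 2)
    (n : ℕ) (hsing : ¬ IsRegularLocalRing ↥(tower O A (n + 1))) (S : Subalgebra k K)
    (hTS : tower O A (n + 1) ≤ S) (hS : IsRegularLocalRing ↥S) (hSeft : Algebra.EssFiniteType k ↥S)
    (X : Scheme.{0}) (π : X ⟶ Spec (CommRingCat.of ↥(tower O A (n + 1))))
    (hπ : IsMinimalResolution π) :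
    ∃ l : Spec (CommRingCat.of ↥S) ⟶ X,
      l ≫ π = Spec.map (CommRingCat.ofHom (Subalgebra.inclusion hTS).toRingHom) := by
  classical
  obtain ⟨hTnoeth, _, hTfr, hTloc, hdimT, hET⟩ := stage_package_of_trdeg O A hk hA hfr hAO htr n hsing
  haveI := hTnoeth
  haveI := hTfr
  haveI := hTloc
  haveI := hS
  -- `T` is excellent
  have hTexc : IsExcellentRing ↥(tower O A (n + 1)) := (isExcellentRing_of_field k).of_essFiniteType hET
  -- `S` as a `T`-algebra, essentially of finite type
  letI : Algebra ↥(tower O A (n + 1)) ↥S := (Subalgebra.inclusion hTS).toRingHom.toAlgebra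
  haveI : IsScalarTower k ↥(tower O A (n + 1)) ↥S := IsScalarTower.of_algebraMap_eq fun c => rfl
  haveI : Algebra.EssFiniteType k ↥S := hSeft
  haveI : Algebra.EssFiniteType ↥(tower O A (n + 1)) ↥S :=
    Algebra.EssFiniteType.of_comp k ↥(tower O A (n + 1)) ↥S
  -- the finitely generated model `B₀ ⊆ S` and the prime `𝔮 = 𝔪_S ∩ B₀`
  set B₀ : Subalgebra ↥(tower O A (n + 1)) ↥S :=
    Algebra.EssFiniteType.subalgebra ↥(tower O A (n + 1)) ↥S with hB₀
  let 𝔮 : Ideal ↥B₀ := (maximalIdeal ↥S).comap (algebraMap ↥B₀ ↥S)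
  haveI : 𝔮.IsPrime := Ideal.comap_isPrime _ _
  have hsub : Algebra.EssFiniteType.submonoid ↥(tower O A (n + 1)) ↥S = 𝔮.primeCompl := by
    ext x
    simp only [Algebra.EssFiniteType.submonoid, Submonoid.mem_comap, IsUnit.mem_submonoid_iff,
      Ideal.primeCompl, 𝔮]
    change _ ↔ algebraMap (↥B₀) (↥S) x ∉ maximalIdeal ↥S
    rw [IsLocalRing.mem_maximalIdeal, mem_nonunits_iff, not_not]
  haveI : IsLocalization.AtPrime ↥S 𝔮 := by
    rw [IsLocalization.AtPrime, ← hsub]; infer_instance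
  -- injectivity of `T → B₀` and the common denominator
  have hcoe : ∀ a : ↥(tower O A (n + 1)), (((algebraMap ↥(tower O A (n + 1)) ↥B₀ a : ↥B₀) : ↥S) : K) =
      (a : K) := fun a => rfl
  have hinj : Function.Injective (algebraMap ↥(tower O A (n + 1)) ↥B₀) := by
    intro a b h
    have := congrArg (fun x : ↥B₀ => ((x : ↥S) : K)) h
    simp only [hcoe] at this
    exact Subtype.ext this
  obtain ⟨r, hr0, hden⟩ :=
    exists_denominator_adjoin (tower O A (n + 1)) S hTS
      (Algebra.EssFiniteType.finset ↥(tower O A (n + 1)) ↥S)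
  have hB : ∀ b : ↥B₀, ∃ m : ℕ, ∃ a : ↥(tower O A (n + 1)),
      algebraMap ↥(tower O A (n + 1)) ↥B₀ a = algebraMap ↥(tower O A (n + 1)) ↥B₀ r ^ m * b := by
    intro b
    obtain ⟨m, a, h⟩ := hden b b.2
    refine ⟨m, a, Subtype.ext (Subtype.ext ?_)⟩
    rw [hcoe]
    push_cast
    rw [h]
    rfl
  -- a resolution through `S`, then minimality of `π`
  haveI : IsScalarTower ↥(tower O A (n + 1)) ↥B₀ ↥S := IsScalarTower.of_algebraMap_eq fun _ => rfl
  obtain ⟨X'', ρ, hρ, j, hj⟩ :=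
    exists_isResolution_through_of_cjsGeneral (R := ↥(tower O A (n + 1))) (B := ↥B₀) (S := ↥S)
      hCJS hTexc hdimT.le hinj r hr0 hB 𝔮 hS
  obtain ⟨l, hl⟩ := exists_lift_of_isMinimalResolution_of_through hπ hρ j
  exact ⟨l, by rw [hl, hj]⟩

/-! ## CAPTURE-PRINCIPAL above a rational singular stage -/

/-- **CAPTURE-PRINCIPAL** (object (h3) of chain W4.4's (DESC) = res-L0-w44-stub-4's
`DescentSketch.stub_capturePrincipal`, same binders).  For the canonical `ca`-tower of a two-dimensional
affine model (`tr.deg_k K = 2`), a SINGULAR stage `T = T_(n+1)` with a RATIONAL singularity, and a regular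
local `k`-subalgebra `S ⊇ T` of `K` DOMINATING `T` and essentially of finite type over `k`: the extension
`ca(T)·S` of the cohomology annihilator along `T ↪ S` is principal.  No dimension hypothesis on `S`.
Assembly, modulo the registered six-fact bundle (CJS-General, Lipman (1.2), (4.1), (12.1)(ii), GW 24.44 used;
(12.1)(i) idle): a minimal resolution `π` of `T` (Lipman (4.1)) with `H¹ = 0` (Lipman (1.2) 2)), THEOREM A
for the rational stage at every point of `π` (res-D-pv-045's `caInvertible_of_hasTrivialCechH1`, p517833,
with the `𝔪`-primarity of `ca(T)` from stub-5's `exists_maximalIdeal_pow_le_cohomologyAnnihilator_tower`),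
the lifting lemma (Cossart–Jannsen–Saito), and the lead's bridge `caPrincipal_of_invertible_of_lift`.
[cite: Lipman1969, Theorem (4.1) (p. 204)] [cite: Lipman1969, Proposition (1.2) (p. 199)] -/
theorem isPrincipal_map_ca_of_isRegularLocalRing_dominating
    (hF : (Literature.AlgebraicGeometry.Resolution.CossartJannsenSaito2020General.{0} ∧
      Literature.AlgebraicGeometry.Resolution.Lipman1969_1_2.{0} ∧
      Literature.AlgebraicGeometry.Resolution.Lipman1969_4_1.{0} ∧
      Literature.AlgebraicGeometry.Resolution.Lipman1969_12_1_i.{0} ∧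
      Literature.AlgebraicGeometry.Resolution.Lipman1969_12_1_ii.{0} ∧
      Literature.AlgebraicGeometry.Morphisms.GortzWedhorn2023_24_44_H2.{0}))
    (O : ValuationSubring K) (A : Subalgebra k K) (hk : ∀ c : k, algebraMap k K c ∈ O) (hA : A.FG)
    (hfr : IsFractionRing ↥A K) (hAO : A.toSubring ≤ O.toSubring) (htr : Algebra.trdeg k K = 2)
    (n : ℕ) (hsing : ¬ IsRegularLocalRing ↥(tower O A (n + 1)))
    (hrat : HasRationalSingularity ↥(tower O A (n + 1)))
    (S : Subalgebra k K) (hTS : tower O A (n + 1) ≤ S)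
    (hdomS : ∀ t ∈ tower O A (n + 1), t⁻¹ ∈ S → t⁻¹ ∈ tower O A (n + 1))
    (hSreg : IsRegularLocalRing ↥S) (hSeft : Algebra.EssFiniteType k ↥S) :
    (Ideal.map (Subalgebra.inclusion hTS).toRingHom (cohomologyAnnihilator ↥(tower O A (n + 1)))).IsPrincipal := by
  classical
  obtain ⟨hCJS, h12, h41, -, h121ii, hGW⟩ := hF
  obtain ⟨hTnoeth, hTnorm, hTfr, hTloc, hdimT, -⟩ := stage_package_of_trdeg O A hk hA hfr hAO htr n hsing
  haveI := hTnoeth; haveI := hTnorm; haveI := hTfr; haveI := hTloc; haveI := hSreg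
  -- a minimal resolution of the rational stage, with `H¹ = 0`
  obtain ⟨X, π, hπ⟩ := h41.exists_isMinimalResolution_Spec ↥(tower O A (n + 1)) hdimT hrat
  haveI : IsIntegral X := hπ.isResolution.isIntegral_source
  haveI : IsProper π := hπ.isResolution.isProper
  haveI : IsLocallyNoetherian X := AlgebraicGeometry.LocallyOfFiniteType.isLocallyNoetherian π
  have hH1 : HasTrivialCechH1 π := h12.hasTrivialCechH1_of_isResolution hdimT hrat π hπ.isResolution
  have hca : ∃ c : ℕ, maximalIdeal ↥(tower O A (n + 1)) ^ c ≤ cohomologyAnnihilator ↥(tower O A (n + 1)) :=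
    exists_maximalIdeal_pow_le_cohomologyAnnihilator_tower O A hk hA hfr hAO htr n
  -- THEOREM A for the rational stage (res-D-pv-045), at every point of `π`
  have hG : ∀ x : X, π x = closedPoint ↥(tower O A (n + 1)) →
      (Ideal.map (((X.presheaf.germ ⊤ x trivial).hom.comp
        (π.appTop.hom.comp (Scheme.ΓSpecIso (.of ↥(tower O A (n + 1)))).inv.hom)) :
          ↥(tower O A (n + 1)) →+* X.presheaf.stalk x)
        (cohomologyAnnihilator ↥(tower O A (n + 1)))).IsPrincipal :=
    fun x _ => caInvertible_of_hasTrivialCechH1 π h121ii hGW hdimT hca hπ.isResolution hH1 x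
  -- the lift and the bridge
  exact caPrincipal_of_invertible_of_lift (tower O A (n + 1)) S hTS hdomS π hG
    (exists_lift_of_isRegularLocalRing_of_essFiniteType hCJS O A hk hA hfr hAO htr n hsing S hTS hSreg hSeft
      X π hπ)

/-- The same with the conclusion in the `span` form of the cluster statements
(`Ideal.span {s : S | (s : K) ∈ ca T}`, cf. `span_ca_eq_map_inclusion`). [this work] -/
theorem span_ca_isPrincipal_of_isRegularLocalRing_dominating
    (hF : (Literature.AlgebraicGeometry.Resolution.CossartJannsenSaito2020General.{0} ∧
      Literature.AlgebraicGeometry.Resolution.Lipman1969_1_2.{0} ∧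
      Literature.AlgebraicGeometry.Resolution.Lipman1969_4_1.{0} ∧
      Literature.AlgebraicGeometry.Resolution.Lipman1969_12_1_i.{0} ∧
      Literature.AlgebraicGeometry.Resolution.Lipman1969_12_1_ii.{0} ∧
      Literature.AlgebraicGeometry.Morphisms.GortzWedhorn2023_24_44_H2.{0}))
    (O : ValuationSubring K) (A : Subalgebra k K) (hk : ∀ c : k, algebraMap k K c ∈ O) (hA : A.FG)
    (hfr : IsFractionRing ↥A K) (hAO : A.toSubring ≤ O.toSubring) (htr : Algebra.trdeg k K = 2)
    (n : ℕ) (hsing : ¬ IsRegularLocalRing ↥(tower O A (n + 1)))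
    (hrat : HasRationalSingularity ↥(tower O A (n + 1)))
    (S : Subalgebra k K) (hTS : tower O A (n + 1) ≤ S)
    (hdomS : ∀ t ∈ tower O A (n + 1), t⁻¹ ∈ S → t⁻¹ ∈ tower O A (n + 1))
    (hSreg : IsRegularLocalRing ↥S) (hSeft : Algebra.EssFiniteType k ↥S) :
    (Ideal.span {s : ↥S | (s : K) ∈ ca (tower O A (n + 1))}).IsPrincipal := by
  rw [span_ca_eq_map_inclusion (tower O A (n + 1)) S hTS]
  exact isPrincipal_map_ca_of_isRegularLocalRing_dominating hF O A hk hA hfr hAO htr n hsing hrat S hTS hdomS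
    hSreg hSeft

end Summit.ResolutionOfSingularities.ResolutionOfSingularities.Theorems.SurfaceTermination.RationalDescent

end
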